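import Summits.ResolutionOfSingularities.ResolutionOfSingularities.Theorems.WeightedInvariantE2LemmaHGeneric
import Summits.ResolutionOfSingularities.ResolutionOfSingularities.Theorems.WeightedInvariantE2HomKernel
import Summits.ResolutionOfSingularities.ResolutionOfSingularities.Theorems.WeightedInvariantELadderTwoCentreOfHom
import HarnessLib

/-!
# E2 centre, word (G-6b) `e2CentreHom` FROM LEMMA H′: `E2CentreHomBody` (hence `stub_e2_centre_h`) from the single remaining input
# «(a′)» — the ASSOCIATED POINTS of `Γ(W) ⧸ Rₙ(W)` are maximal points of `closure (maxLocus₂)`, read by `J`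

Route `ResolutionOfSingularities/WeightedInvariant`, crux `Theses.WeightedInvariant.HypersurfaceCentreConstruction`
(stmt-ResolutionOfSingularities-19897), door line `local-engine` (skeleton v3.12), E2 tier, registered stub `stub_e2_centre_h`, resting on the
single word (G-6b) `PRungGrHomLE 3 p ι J → E2HomogeneousChartBody p ι J → E2CentreHomBody p ι J` (`…ELadderTwoCentreOfHom`).  Proof route
«LEMMA H» (`Cruxes/HypersurfaceCentreConstruction/G6B-LEMMA-H.md`): (G-6b) = the (G-6a) kernel (…E2HomKernel) + LEMMA H (…E2LemmaH, PROVED) + the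
work list (a)…(e).  This file does (b)–(e) of that list IN THE KERNEL and isolates (a) as the ONE remaining hypothesis, stated inline:

«(a′)» for every stage `S` with (I0)₂ and `X` not regular, every canonical e = 2 centre `R` that is stalkwise maximal, every affine open `W` and
every `n`: each associated prime of `Γ(S.Y, W) ⧸ Rₙ(W)` is the prime `𝔭_W(ξ)` of a point `ξ ∈ W ∩ closure (maxLocus₂)` maximal in
`closure (maxLocus₂)` under generisation (NO EMBEDDED POINTS: memo step 1, from stalkwise maximality), with `dim 𝒪_{Y,ξ} ≤ 3` and `Rₙ` READ BY `J`
at `ξ` (`(Rₙ)_ξ = J(𝒪_ξ, f_ξ)ₙ` — at points of `maxLocus₂` this is `IsCanonicalCentre₂.stalkIdeal_eq`; at a generic point `ξ ∉ maxLocus₂` of a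
component (e.g. `j = 0`, a curve of maximal closed points) it is the localisation clause of (c9′-hom) along the centre prime).  «(a′)» is what
remains of (G-6b).

Given «(a′)», for `𝔮 = 𝔭_W(ξ) ∈ Ass`: LEMMA H′ (…E2LemmaHGeneric) makes `𝔮` homogeneous for the foreign grading `𝒜` (so `𝔮* = 𝔮`), the J-READING
`Rₙ(W)·A_𝔮 = J(A_𝔮, F/1)ₙ` holds on the model for a HOMOGENEOUS local generator `F` (…E2LemmaHCorePoint's `exists_isHomogeneousElem_localGenerator`,
the stalk reading moved along `stalkEquiv`: `map_localization_eq_J_of_stalkIdeal_eq`), and the twist-stability asked by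
`E2Model.isHomogeneous_of_twistStable_associatedPrimes` is `E2Model.J_map_localization_homogeneousCore_eq` at `𝔮' = 𝔮` ((c11)≤3 + `JUnitInvariant`
from the rung; `A_𝔮` regular of dimension `≤ 3`).  Results: `e2CentreHomBody_of_assMaximal`, the registrar shape
`e2CentreHom_of_assMaximal`, and `stub_e2_centre_h_of_assMaximal` (the registered stub's statement from «(a′)» alone, via `stub_e2_centre_h_of_hom`).
The constants-in-degree-`0` clause and `E2HomogeneousChartBody` are idle.  Def-free helper (`--supports stmt-ResolutionOfSingularities-19897`); nothing
here asserts any clause or anything about resolution of singularities in characteristic `p`; AI-written, weaker than expert review. [OURS · L1 W4.3]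
-/

noncomputable section

set_option linter.dupNamespace false -- mandated namespace of this single-conjunct summit

open CategoryTheory AlgebraicGeometry TopologicalSpace IsLocalRing Topology
open Literature.AlgebraicGeometry.Resolution
open Summit.ResolutionOfSingularities.ResolutionOfSingularities.Theorems
open Summit.ResolutionOfSingularities.ResolutionOfSingularities.Theorems.ELadderOne

namespace Summit.ResolutionOfSingularities.ResolutionOfSingularities.Cruxes.HypersurfaceCentreConstruction.LocalEngine

/-! ## The stalk dictionary for `J` and for an ideal sheaf, from `X(U)·A_𝔮 = (F/1)` -/

section Dict

variable (J : (R : Type) → [CommRing R] → R → ℕ → Ideal R)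
  {Y : Scheme.{0}} (X : Y.IdealSheafData) (U : Y.affineOpens) {y : Y} (hy : y ∈ (U : Y.Opens))

/-- **`J` at a point, read on the localized model, from `X(U)·A_𝔮 = (F/1)`** (for `Y → Spec k` smooth; `JIsoInvariant` along `stalkEquiv`,
`JUnitInvariant` for the two local equations). [folklore] -/
theorem J_localGenerator_eq_map_of_map_eq {k : Type} [Field k] (f : Y ⟶ Spec (.of k)) [Smooth f]
    (hJ : JIsoInvariant J) (hJu : JUnitInvariant J) {F : Γ(Y, U)}
    (hFmap : (X.ideal U).map (algebraMap Γ(Y, U) (Localization.AtPrime (U.2.primeIdealOf ⟨y, hy⟩).asIdeal)) =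
      Ideal.span {algebraMap Γ(Y, U) (Localization.AtPrime (U.2.primeIdealOf ⟨y, hy⟩).asIdeal) F}) (n : ℕ) :
    J (Y.presheaf.stalk y) (localGenerator X y) n =
      (J (Localization.AtPrime (U.2.primeIdealOf ⟨y, hy⟩).asIdeal)
        (algebraMap Γ(Y, U) (Localization.AtPrime (U.2.primeIdealOf ⟨y, hy⟩).asIdeal) F) n).map
        (stalkEquiv U hy : _ →+* Y.presheaf.stalk y) := by
  haveI : IsRegularLocalRing (Y.presheaf.stalk y) := isRegularLocalRing_stalk_of_smooth_of_field f y
  haveI : IsDomain (Y.presheaf.stalk y) := isDomain_of_isRegularLocalRing (Y.presheaf.stalk y)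
  have hst := stalkIdeal_eq_span_germ_of_map_eq X U hy hFmap
  have hgen : Ideal.span {localGenerator X y} = Ideal.span {(Y.presheaf.germ (U : Y.Opens) y hy).hom F} := by
    rw [← stalkIdeal_eq_span_localGenerator X y ⟨_, hst⟩, hst]
  rw [J_eq_of_span_singleton_eq J hJu hgen n, ← stalkEquiv_algebraMap U hy F]
  exact hJ _ _ (stalkEquiv U hy) (algebraMap Γ(Y, U) (Localization.AtPrime (U.2.primeIdealOf ⟨y, hy⟩).asIdeal) F) n

/-- **An ideal sheaf READ BY `J` at a point is read by `J` on the model**: if `K_y = J(𝒪_{Y,y}, f_y)ₙ` and `X(U)·A_𝔮 = (F/1)`, then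
`K(U)·A_𝔮 = J(A_𝔮, F/1)ₙ`. [folklore] -/
theorem map_localization_eq_J_of_stalkIdeal_eq {k : Type} [Field k] (f : Y ⟶ Spec (.of k)) [Smooth f]
    (hJ : JIsoInvariant J) (hJu : JUnitInvariant J) {F : Γ(Y, U)}
    (hFmap : (X.ideal U).map (algebraMap Γ(Y, U) (Localization.AtPrime (U.2.primeIdealOf ⟨y, hy⟩).asIdeal)) =
      Ideal.span {algebraMap Γ(Y, U) (Localization.AtPrime (U.2.primeIdealOf ⟨y, hy⟩).asIdeal) F}) {n : ℕ}
    (K : Y.IdealSheafData) (hK : stalkIdeal K y = J (Y.presheaf.stalk y) (localGenerator X y) n) :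
    (K.ideal U).map (algebraMap Γ(Y, U) (Localization.AtPrime (U.2.primeIdealOf ⟨y, hy⟩).asIdeal)) =
      J (Localization.AtPrime (U.2.primeIdealOf ⟨y, hy⟩).asIdeal)
        (algebraMap Γ(Y, U) (Localization.AtPrime (U.2.primeIdealOf ⟨y, hy⟩).asIdeal) F) n := by
  have h1 : ((K.ideal U).map (algebraMap Γ(Y, U) (Localization.AtPrime (U.2.primeIdealOf ⟨y, hy⟩).asIdeal))).map
      (stalkEquiv U hy : _ →+* Y.presheaf.stalk y) =
      (J (Localization.AtPrime (U.2.primeIdealOf ⟨y, hy⟩).asIdeal)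
        (algebraMap Γ(Y, U) (Localization.AtPrime (U.2.primeIdealOf ⟨y, hy⟩).asIdeal) F) n).map
        (stalkEquiv U hy : _ →+* Y.presheaf.stalk y) := by
    rw [map_stalkEquiv_map U hy, ← stalkIdeal_eq_map_germ K U hy, hK, J_localGenerator_eq_map_of_map_eq J X U hy f hJ hJu hFmap n]
  have h2 : ∀ I₁ I₂ : Ideal (Localization.AtPrime (U.2.primeIdealOf ⟨y, hy⟩).asIdeal),
      I₁.map (stalkEquiv U hy : _ →+* Y.presheaf.stalk y) = I₂.map (stalkEquiv U hy : _ →+* Y.presheaf.stalk y) →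
        I₁ = I₂ := by
    intro I₁ I₂ h
    rw [← Ideal.map_of_equiv (I := I₁) (stalkEquiv U hy), h, Ideal.map_of_equiv]
  exact h2 _ _ h1

end Dict

/-! ## (G-6b) from «(a′)» -/

/-- **`E2CentreHomBody p ι J` FROM «(a′)»** (associated points of `Γ(W) ⧸ Rₙ(W)` are maximal points of `closure (maxLocus₂)` of dimension `≤ 3`
read by `J`), under the graded HOM rung — via LEMMA H′ and the (G-6a) twist-stability kernel. [folklore] -/
theorem e2CentreHomBody_of_assMaximal (p : ℕ) (ι : (R : Type) → [CommRing R] → R → Ordinal.{0})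
    (J : (R : Type) → [CommRing R] → R → ℕ → Ideal R) (hr : PRungGrHomLE 3 p ι J)
    (hass : ∀ ⦃k : Type⦄ [Field k] [CharP k p] [PerfectField k] (S : Stage k), S.InvDim₂ → ¬ Scheme.IsRegular S.X →
      ∀ (R : ReesAlgebraData S.Y), S.IsCanonicalCentre₂ ι J R →
      (∀ (n : ℕ) (K : S.Y.IdealSheafData),
        (∀ η ∈ S.maxLocus₂ ι, stalkIdeal K η ≤ J (S.Y.presheaf.stalk η) (localGenerator S.i.ker η) n) → K ≤ R.piece n) →
      ∀ (W : S.Y.affineOpens) (n : ℕ), ∀ 𝔮 ∈ associatedPrimes Γ(S.Y, W) (Γ(S.Y, W) ⧸ (R.piece n).ideal W),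
        ∃ (ξ : S.Y) (hξW : ξ ∈ (W : S.Y.Opens)), (W.2.primeIdealOf ⟨ξ, hξW⟩).asIdeal = 𝔮 ∧ ξ ∈ closure (S.maxLocus₂ ι) ∧
          (∀ y' ∈ closure (S.maxLocus₂ ι), y' ⤳ ξ → ξ ⤳ y') ∧
          ringKrullDim (S.Y.presheaf.stalk ξ) ≤ ((3 : ℕ) : WithBot ℕ∞) ∧
          stalkIdeal (R.piece n) ξ = J (S.Y.presheaf.stalk ξ) (localGenerator S.i.ker ξ) n) :
    E2CentreHomBody p ι J := by
  intro k _ _ _ S h0 hXreg R hR hmaxR j W 𝒜 _ _h0deg hXhom n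
  classical
  have hc11 : IotaJEssSmoothCompatibleLE 3 ι J := hr.1.2.2.2.2.2.1
  have hJ : JIsoInvariant J := hr.1.2.2.2.2.1
  have hJu : JUnitInvariant J := hr.1.2.2.2.2.2.2.2.2.2
  haveI : IsLocallyNoetherian S.Y := LocallyOfFiniteType.isLocallyNoetherian S.f
  haveI : IsNoetherianRing Γ(S.Y, W) := IsLocallyNoetherian.component_noetherian W
  refine E2Model.isHomogeneous_of_twistStable_associatedPrimes 𝒜 ((R.piece n).ideal W) ?_
  intro 𝔮 h𝔮 h𝔮p 𝔮' h𝔮'p h𝔮' ρ hρ 𝔔 h𝔔p h𝔔 h1 h2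
  obtain ⟨η, hηW, hη𝔮, hηM, hmax, hdimη, hreadη⟩ := hass S h0 hXreg R hR hmaxR W n 𝔮 h𝔮
  subst hη𝔮
  -- LEMMA H′: `𝔮` is homogeneous, so `𝔮' = 𝔮`
  have hhom : ((W.2.primeIdealOf ⟨η, hηW⟩).asIdeal).IsHomogeneous 𝒜 :=
    S.isHomogeneous_primeIdealOf_of_maximal_closure ι J hr h0 W 𝒜 hXhom hηW hηM hmax
  have e' : 𝔮' = (W.2.primeIdealOf ⟨η, hηW⟩).asIdeal := h𝔮'.trans hhom.toIdeal_homogeneousCore_eq_self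
  subst e'
  haveI := h𝔔p
  -- a HOMOGENEOUS local generator of `𝓘(X)(W)` at `η`, and the J-reading of `Rₙ(W)` at `η ∈ maxLocus₂`
  obtain ⟨F, g', hFI, hFh, -, hg'𝔮, hg'⟩ := exists_isHomogeneousElem_localGenerator S.i.ker S.isLocallyPrincipal W hηW 𝒜 hXhom
  have hFmap : (S.i.ker.ideal W).map (algebraMap Γ(S.Y, W) (Localization.AtPrime (W.2.primeIdealOf ⟨η, hηW⟩).asIdeal)) =
      Ideal.span {algebraMap Γ(S.Y, W) (Localization.AtPrime (W.2.primeIdealOf ⟨η, hηW⟩).asIdeal) F} :=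
    map_localization_eq_span_of_smul_le (S.i.ker.ideal W) _ hFI hg'𝔮 hg'
  have hread : ((R.piece n).ideal W).map (algebraMap Γ(S.Y, W) (Localization.AtPrime (W.2.primeIdealOf ⟨η, hηW⟩).asIdeal)) =
      J (Localization.AtPrime (W.2.primeIdealOf ⟨η, hηW⟩).asIdeal)
        (algebraMap Γ(S.Y, W) (Localization.AtPrime (W.2.primeIdealOf ⟨η, hηW⟩).asIdeal) F) n :=
    map_localization_eq_J_of_stalkIdeal_eq J S.i.ker W hηW S.f hJ hJu hFmap (R.piece n) hreadη
  -- `A_𝔮` is regular of dimension `≤ 3`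
  haveI : IsRegularLocalRing (S.Y.presheaf.stalk η) := isRegularLocalRing_stalk_of_smooth_of_field S.f η
  haveI hreg : IsRegularLocalRing (Localization.AtPrime (W.2.primeIdealOf ⟨η, hηW⟩).asIdeal) :=
    IsRegularLocalRing.of_ringEquiv (stalkEquiv W hηW).symm
  have hd : ringKrullDim (Localization.AtPrime (W.2.primeIdealOf ⟨η, hηW⟩).asIdeal) ≤ (3 : ℕ) := by
    rw [ringKrullDim_eq_of_ringEquiv (stalkEquiv W hηW)]
    exact hdimη
  rw [hread]
  exact (E2Model.J_map_localization_homogeneousCore_eq 𝒜 _ _ hc11 hJu hd hFh ρ hρ 𝔔 h𝔔 h1 h2 n).symm.le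

/-- **The word (G-6b) in the registrar's shape, from «(a′)».** [folklore] -/
theorem e2CentreHom_of_assMaximal (p : ℕ) (ι : (R : Type) → [CommRing R] → R → Ordinal.{0})
    (J : (R : Type) → [CommRing R] → R → ℕ → Ideal R)
    (hass : ∀ ⦃k : Type⦄ [Field k] [CharP k p] [PerfectField k] (S : Stage k), S.InvDim₂ → ¬ Scheme.IsRegular S.X →
      ∀ (R : ReesAlgebraData S.Y), S.IsCanonicalCentre₂ ι J R →
      (∀ (n : ℕ) (K : S.Y.IdealSheafData),
        (∀ η ∈ S.maxLocus₂ ι, stalkIdeal K η ≤ J (S.Y.presheaf.stalk η) (localGenerator S.i.ker η) n) → K ≤ R.piece n) →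
      ∀ (W : S.Y.affineOpens) (n : ℕ), ∀ 𝔮 ∈ associatedPrimes Γ(S.Y, W) (Γ(S.Y, W) ⧸ (R.piece n).ideal W),
        ∃ (ξ : S.Y) (hξW : ξ ∈ (W : S.Y.Opens)), (W.2.primeIdealOf ⟨ξ, hξW⟩).asIdeal = 𝔮 ∧ ξ ∈ closure (S.maxLocus₂ ι) ∧
          (∀ y' ∈ closure (S.maxLocus₂ ι), y' ⤳ ξ → ξ ⤳ y') ∧
          ringKrullDim (S.Y.presheaf.stalk ξ) ≤ ((3 : ℕ) : WithBot ℕ∞) ∧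
          stalkIdeal (R.piece n) ξ = J (S.Y.presheaf.stalk ξ) (localGenerator S.i.ker ξ) n) :
    PRungGrHomLE 3 p ι J → E2HomogeneousChartBody p ι J → E2CentreHomBody p ι J :=
  fun hr _ => e2CentreHomBody_of_assMaximal p ι J hr hass

/-- **The registered stub `stub_e2_centre_h` BY ITS STATEMENT from «(a′)» alone** (for every prime and every pair carrying the graded HOM rung),
via `stub_e2_centre_h_of_hom`. [folklore] -/
theorem stub_e2_centre_h_of_assMaximal
    (hass : ∀ p : ℕ, p.Prime → ∀ (ι : (R : Type) → [CommRing R] → R → Ordinal.{0})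
      (J : (R : Type) → [CommRing R] → R → ℕ → Ideal R), PRungGrHomLE 3 p ι J →
      ∀ ⦃k : Type⦄ [Field k] [CharP k p] [PerfectField k] (S : Stage k), S.InvDim₂ → ¬ Scheme.IsRegular S.X →
      ∀ (R : ReesAlgebraData S.Y), S.IsCanonicalCentre₂ ι J R →
      (∀ (n : ℕ) (K : S.Y.IdealSheafData),
        (∀ η ∈ S.maxLocus₂ ι, stalkIdeal K η ≤ J (S.Y.presheaf.stalk η) (localGenerator S.i.ker η) n) → K ≤ R.piece n) →
      ∀ (W : S.Y.affineOpens) (n : ℕ), ∀ 𝔮 ∈ associatedPrimes Γ(S.Y, W) (Γ(S.Y, W) ⧸ (R.piece n).ideal W),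
        ∃ (ξ : S.Y) (hξW : ξ ∈ (W : S.Y.Opens)), (W.2.primeIdealOf ⟨ξ, hξW⟩).asIdeal = 𝔮 ∧ ξ ∈ closure (S.maxLocus₂ ι) ∧
          (∀ y' ∈ closure (S.maxLocus₂ ι), y' ⤳ ξ → ξ ⤳ y') ∧
          ringKrullDim (S.Y.presheaf.stalk ξ) ≤ ((3 : ℕ) : WithBot ℕ∞) ∧
          stalkIdeal (R.piece n) ξ = J (S.Y.presheaf.stalk ξ) (localGenerator S.i.ker ξ) n) :
    ∀ p : ℕ, p.Prime → ∀ (ι : (R : Type) → [CommRing R] → R → Ordinal.{0})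
      (J : (R : Type) → [CommRing R] → R → ℕ → Ideal R), E2CentreH p ι J :=
  stub_e2_centre_h_of_hom fun p hp ι J hr _ => e2CentreHomBody_of_assMaximal p ι J hr (hass p hp ι J hr)

end Summit.ResolutionOfSingularities.ResolutionOfSingularities.Cruxes.HypersurfaceCentreConstruction.LocalEngine

end
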